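import Literature.Probability.LatticeModels.RandomCluster
import Literature.Probability.LatticeModels.IsingThermodynamics
import Literature.Probability.Percolation.PercolationEvents
import Mathlib.Order.UpperLower.Basic
import HarnessLib

/-!
# Route `FKParityRobustness`, crux `FKFourConnectivity` (stmt-CriticalPhenomena-11254):
# vocabulary of the line `cluster-hole-opacity`

Route-posited objects (D-0016 `<Route>Defs`-type vocabulary file, companion of
`Theorems/FKParityRobustnessDefs.lean`) shared by the registered stubs of the skeleton
`Cruxes/FKFourConnectivity/Lines/cluster-hole-opacity.lean` and by the crux file that composes
them.  Everything here is a plain finite-graph / lattice definition over the tree's `openGraph`,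
`openCluster`, `openConn` (`Literature/Probability/Percolation/Percolation.lean`), `rcMeasure`,
`fkIsingParam` (`RandomCluster.lean`), `box`, `zdGraph`, `Site` (`LatticeGraph.lean`) and
`criticalBeta` (`IsingThermodynamics.lean`); nothing is asserted except the closed-form bookkeeping
stub `stub_holeLower` (registered stub of the skeleton: the hole event is decreasing), proved here.

* the box setting of the crux: `tetra` (the unit tetrahedron of the route, verbatim the crux's
  `let tetra`), `boxGraph N = (zdGraph 3).comap Subtype.val` on `↥(box 3 N)` (verbatim the crux's
  `let G`), `fkBox N` (verbatim the crux's `let φ`); `tetra_inj`, `tetra_injective`;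
* `hole K` — the decreasing event "no open edge touches the vertex set `K`"; `isLowerSet_hole`;
* `holedGraph G K` — `G` with every edge touching `K` deleted (same vertex type; the vertices of
  `K` become isolated); NO `DecidableRel` instance is provided on purpose: the registered stub
  signatures were elaborated under `open scoped Classical` (as here), and every consumer must do the
  same so that the instance terms inside `rcMeasure (holedGraph G K) …` / `isingTwoPoint (holedGraph G K) …`
  coincide syntactically;
* `ThickAt K j z`, `lvl l`, `IsThick l K`, `thickEvent l N x` — the explicit deterministic family of
  dyadically 2-THICK vertex sets at tetrahedral scale `l` (a dyadic box of side `2^(lvl l)`,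
  `lvl l = ⌊log₂ l⌋ − 3`, keeping `≥ 4` of its `8` children thick at every level, leaves = sites
  of `K`) and the event "the open cluster of `x` is 2-thick at scale `l`".

References: the line card `Cruxes/FKFourConnectivity/Lines/cluster-hole-opacity.md` and idea card
`Cruxes/FKFourConnectivity/Ideas/cluster-hole-opacity.md`; G. Grimmett, *The Random-Cluster
Model* (2006), Thm (3.1)(a), Lemma (4.13) (domain Markov property behind `hole`/`holedGraph`).
-/

noncomputable section

open MeasureTheory Finset
open Literature.Probability.LatticeModels Literature.Probability.Percolation

namespace Summit.CriticalPhenomena.Ising3DConformalLimit.Cruxes.FKFourConnectivity.ClusterHoleOpacity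

open scoped Classical

/-! ### The box setting of the crux -/

/-- The unit tetrahedron `{(−1,−1,−1), (1,1,−1), (1,−1,1), (−1,1,1)}` of the route (verbatim the
crux's `let tetra`); the sources of the crux are `a = l • tetra`, `l ≥ 1`. -/
def tetra : Fin 4 → Site 3 := ![![-1, -1, -1], ![1, 1, -1], ![1, -1, 1], ![-1, 1, 1]]

/-- The four vertices of the unit tetrahedron are distinct. -/
theorem tetra_inj : Function.Injective tetra := by
  unfold tetra
  decide

/-- The sources `a = l • tetra` (`l ≥ 1`) are four distinct vertices of the box. -/
theorem tetra_injective {l : ℕ} (hl : 1 ≤ l) {N : ℕ} (a : Fin 4 → ↥(box 3 N))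
    (ha : ∀ i, ((a i : Site 3)) = (l : ℤ) • tetra i) : Function.Injective a := by
  intro i j hij
  have h : (l : ℤ) • tetra i = (l : ℤ) • tetra j := by rw [← ha i, ← ha j, hij]
  have hl0 : (l : ℤ) ≠ 0 := by exact_mod_cast (show l ≠ 0 by omega)
  exact tetra_inj (smul_right_injective (Site 3) hl0 h)

/-- The nearest-neighbour graph induced on the box `Λ_N = {−N..N}³` (verbatim the crux's `let G`). -/
abbrev boxGraph (N : ℕ) : SimpleGraph ↥(box 3 N) := (zdGraph 3).comap Subtype.val

/-- The free critical FK-Ising measure of `Λ_N` (verbatim the crux's `let φ`). -/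
abbrev fkBox (N : ℕ) : Measure (BondConfig ↥(box 3 N)) :=
  rcMeasure (boxGraph N) (fkIsingParam (criticalBeta 3)) 2 ∅

/-! ### Holes -/

section General

variable {V : Type*}

/-- The HOLE event of a vertex set `K`: no open edge touches `K` (every edge with an endpoint in `K`
is closed).  Decreasing.  Conditioning the free FK measure on it gives the free FK measure of the
holed graph (the vertices of `K` become isolated). -/
def hole (K : Set V) : Set (BondConfig V) := {ω | ∀ e ∈ ω, ∀ v ∈ K, v ∉ e}

/-- Membership in `hole K`, unfolded. -/
theorem mem_hole {K : Set V} {ω : BondConfig V} : ω ∈ hole K ↔ ∀ e ∈ ω, ∀ v ∈ K, v ∉ e :=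
  Iff.rfl

/-- `hole K` is a decreasing event. -/
theorem isLowerSet_hole (K : Set V) : IsLowerSet (hole K) := by
  intro ω ω' hle hω e he v hv
  exact hω e (hle he) v hv

/-- `hole ∅` is the sure event. -/
@[simp] theorem hole_empty : hole (∅ : Set V) = Set.univ := by
  ext ω
  simp [hole]

/-- Holes are antitone in the vertex set. -/
theorem hole_mono {K K' : Set V} (h : K ⊆ K') : hole K' ⊆ hole K :=
  fun _ hω e he v hv => hω e he v (h hv)

/-- The HOLED GRAPH: `G` with every edge touching `K` deleted (same vertex type; the vertices of `K`
are isolated, so under the free Ising model of the holed graph their spins are independent fair signs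
and `⟨σ_yσ_y'⟩` for `y, y' ∉ K` is the correlation of the Ising model on `G ∖ K` with free boundary
condition on the hole). -/
def holedGraph (G : SimpleGraph V) (K : Set V) : SimpleGraph V where
  Adj u v := G.Adj u v ∧ u ∉ K ∧ v ∉ K
  symm := ⟨fun _ _ h => ⟨h.1.symm, h.2.2, h.2.1⟩⟩
  loopless := ⟨fun _ h => h.1.ne rfl⟩

/-- Adjacency in the holed graph, unfolded. -/
theorem holedGraph_adj {G : SimpleGraph V} {K : Set V} {u v : V} :
    (holedGraph G K).Adj u v ↔ G.Adj u v ∧ u ∉ K ∧ v ∉ K :=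
  Iff.rfl

/-- The holed graph is a subgraph of `G`. -/
theorem holedGraph_le (G : SimpleGraph V) (K : Set V) : holedGraph G K ≤ G :=
  fun _ _ h => h.1

/-- Holing at the empty set does nothing. -/
@[simp] theorem holedGraph_empty (G : SimpleGraph V) : holedGraph G (∅ : Set V) = G := by
  ext u v
  simp [holedGraph_adj]

/-- Registered bookkeeping stub `stub_holeLower` of the skeleton `Lines/cluster-hole-opacity.lean`
(crux `FKFourConnectivity`, stmt-CriticalPhenomena-11254): the hole event is decreasing — the
monotonicity through which the FKG mixed form bounds the holed connection probability in the
composition (`isLowerSet_hole` in closed form). -/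
theorem stub_holeLower : ∀ (V : Type) (K : Set V), IsLowerSet (hole K) :=
  fun _ K => isLowerSet_hole K

end General

/-! ### Dyadic 2-thickness (the explicit deterministic family of opaque holes) -/

/-- `ThickAt K j z`: the dyadic box of side `2^j` with lower corner `z` is 2-THICK for `K`:
at level `0` the site `z` lies in `K`; at level `j+1` at least `4` of the `8` children (side `2^j`,
corners `z + 2^j v`, `v ∈ {0,1}³`) are 2-thick.  A 2-thick box of side `2^j` contains `≥ 4^j` points
of `K` spread like a set of dimension `≥ 2` at every dyadic scale (an `l×l` sheet and a solid cube are
2-thick; a segment, a chemical path or a compact ball of radius `≪` side are not). -/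
def ThickAt (K : Set (Site 3)) : ℕ → Site 3 → Prop
  | 0, z => z ∈ K
  | j + 1, z => 4 ≤ #((Finset.univ : Finset (Fin 3 → Fin 2)).filter
      fun v => ThickAt K j (z + fun i => (2 : ℤ) ^ j * ((v i : ℕ) : ℤ)))

/-- The dyadic level used at tetrahedral scale `l`: boxes of side `2^(⌊log₂ l⌋ − 3) ∈ (l/16, l/8]`
(level `0`, a single site, for `l < 16`). -/
def lvl (l : ℕ) : ℕ := Nat.log 2 l - 3

/-- `K ⊆ ℤ³` is 2-THICK AT SCALE `l`: some dyadic box of level `lvl l` with lower corner in `Λ_{2l}`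
is 2-thick for `K`. -/
def IsThick (l : ℕ) (K : Set (Site 3)) : Prop :=
  ∃ z ∈ box 3 (2 * l), ThickAt K (lvl l) z

/-- The THICK-CLUSTER event in the box `Λ_N`: the open cluster of `x` is 2-thick at scale `l`. -/
def thickEvent (l N : ℕ) (x : ↥(box 3 N)) : Set (BondConfig ↥(box 3 N)) :=
  {ω | IsThick l (Subtype.val '' openCluster ω x)}

/-- Level `0` thickness is membership. -/
@[simp] theorem thickAt_zero {K : Set (Site 3)} {z : Site 3} : ThickAt K 0 z ↔ z ∈ K := Iff.rfl

/-- Thickness is monotone in the set. -/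
theorem ThickAt.mono {K K' : Set (Site 3)} (h : K ⊆ K') : ∀ (j : ℕ) (z : Site 3),
    ThickAt K j z → ThickAt K' j z
  | 0, _, hz => h hz
  | j + 1, z, hz => by
    simp only [ThickAt] at hz ⊢
    refine hz.trans (Finset.card_le_card fun v hv => ?_)
    rw [Finset.mem_filter] at hv ⊢
    exact ⟨hv.1, ThickAt.mono h j _ hv.2⟩

/-- Thickness at scale `l` is monotone in the set (it is an `∃`-substructure property). -/
theorem IsThick.mono {l : ℕ} {K K' : Set (Site 3)} (h : K ⊆ K') (hK : IsThick l K) : IsThick l K' := by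
  obtain ⟨z, hz, ht⟩ := hK
  exact ⟨z, hz, ht.mono h _ _⟩

/-- For `l < 16` the level is `0`, so a set is thick at scale `l` as soon as it meets `Λ_{2l}`. -/
theorem lvl_eq_zero_of_lt {l : ℕ} (hl : l < 16) : lvl l = 0 := by
  unfold lvl
  have : Nat.log 2 l ≤ 3 := by
    rcases Nat.eq_zero_or_pos l with rfl | hpos
    · simp
    · have : Nat.log 2 l < 4 := Nat.log_lt_of_lt_pow (by omega) (by norm_num; omega)
      omega
  omega

end Summit.CriticalPhenomena.Ising3DConformalLimit.Cruxes.FKFourConnectivity.ClusterHoleOpacity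

end
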